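import Summits.KontsevichZagierPeriods.KontsevichZagierPeriods.Theorems.HermiteRigidityReductionRigidityDupJoinKernel
import Literature.NumberTheory.DiophantineApproximation.PolylogTwoPointsLinearIndependence

/-!
# `ReductionRigidity` (stmt-KontsevichZagierPeriods-3407), line `Sketch`: THE DUPLICATION JOIN ISLAND IS UNCONDITIONAL
# for every `N ≥ 10⁴⁷` (`stub_dupJoinKernelUnconditional`)

Route `KontsevichZagierPeriods/HermiteRigidity`, crux `ReductionRigidity` (stmt-3407, summit-equivalent; skeleton
`Cruxes/ReductionRigidity/Lines/Sketch.lean` v7). Lead seat c7 (growth item G10 "two-point rigidity"). The lead seat c6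
proved the THREE-LEVEL island `stub_dupJoinKernel` (levels `N`, `−N`, `N²`, joined by the duplication move chains) with
its rigidity INLINED, and `dupJoinKernel_large` over the vended named fact `DHK2020_dilogTwoPointsLinearIndependent`
(David–Hirata-Kohno–Kawashima 2020, Thm 2.1 at the two points `±1/N`). That rigidity is now a THEOREM of the tree for
`N ≥ 10⁴⁷` (`Literature.NumberTheory.DiophantineApproximation.dilogTwoPoints_linearIndependent`, from the parity
Hermite–Padé programme `PolylogTwoPoint*.lean`: `Li_s(±1/N) = 2^{−s}Li_s(1/N²) ± N Θ_s(1/N²)` and the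
`ℚ`-independence of `1, Li_s(1/N²), Θ_s(1/N²)` by type-I forms with the kernel
`4^{wn}(u − wn + 1)_{wn}/(2u+1)_{n+1}^w` and Nesterenko's two-rate criterion), so Conjecture 1 of Kontsevich–Zagier
holds in kernel form on the three-level box sector `{N, −N, N²}` with NO hypothesis for every `N ≥ 10⁴⁷` — the first
unconditional CROSS-LEVEL weight-two island.

References: M. Kontsevich, D. Zagier, *Periods* (2001), §1.2 [cite: KontsevichZagier2001, §1.2]; S. David,
N. Hirata-Kohno, M. Kawashima, Moscow J. Comb. Number Theory 9 (2020), Thm 2.1 [cite: DavidHirataKohnoKawashima2020,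
Thm 2.1]. No definitions are introduced.
-/

noncomputable section

open MeasureTheory Set MvPolynomial

namespace Summit.KontsevichZagierPeriods.HermiteRigidity.ReductionRigidity

open Literature.NumberTheory.Transcendental
open Literature.NumberTheory.Transcendental.KZ

/-- **THE DUPLICATION JOIN ISLAND, UNCONDITIONAL FOR EVERY `N ≥ 10⁴⁷`**: Conjecture 1 of Kontsevich–Zagier in
kernel form on the sector generated by all box generators `[□ʲ, x^a/(ν − ∏x)^m]` (`j ≤ 2`) at the three levels
`ν = N`, `ν = −N`, `ν = N²` — every `ℤ`-combination of value `0` is a chain of moves. It is `stub_dupJoinKernel`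
(lead c6: `levelNormalForm` at each level, the level `N²` eliminated by the weight-one and weight-two duplication move
chains) fed with the PROVED rigidity `dilogTwoPoints_linearIndependent` (`1, Li₁(±1/N), Li₂(±1/N)` are
`ℚ`-linearly independent for `N ≥ 10⁴⁷`), the four normal-form values being the series by
`stub_cubeOneIntegralSeries`, `stub_cubeTwoIntegralSeriesLevel`, `stub_dupJoinValueNegOne/Two`.
[cite: KontsevichZagier2001, §1.2] [cite: DavidHirataKohnoKawashima2020, Thm 2.1] -/
theorem stub_dupJoinKernelUnconditional : ∀ (N : ℕ), 10 ^ 47 ≤ N → ∀ c ∈ AddSubgroup.closure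
      ({c | ∃ (j : ℕ) (r : IntegralRep j) (a : Fin j → ℕ) (m : ℕ), j ≤ 2 ∧ r.domain = cube j ∧
          EqOn r.integrand (fun p => (∏ l, p l ^ a l) / ((N : ℝ) - ∏ l, p l) ^ m) (cube j) ∧ c = KZ.of r} ∪
        {c | ∃ (j : ℕ) (r : IntegralRep j) (a : Fin j → ℕ) (m : ℕ), j ≤ 2 ∧ r.domain = cube j ∧
          EqOn r.integrand (fun p => (∏ l, p l ^ a l) / ((-(N : ℝ)) - ∏ l, p l) ^ m) (cube j) ∧ c = KZ.of r} ∪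
        {c | ∃ (j : ℕ) (r : IntegralRep j) (a : Fin j → ℕ) (m : ℕ), j ≤ 2 ∧ r.domain = cube j ∧
          EqOn r.integrand (fun p => (∏ l, p l ^ a l) / ((N : ℝ) ^ 2 - ∏ l, p l) ^ m) (cube j) ∧ c = KZ.of r}),
      KZ.eval c = 0 → c ∈ KZ.relations := by
  intro N hN
  have hN2 : 2 ≤ N := le_trans (by norm_num) hN
  refine stub_dupJoinKernel N hN2 fun a b₁ c₁ b₂ c₂ h => ?_
  have hNR : (2 : ℝ) ≤ N := by exact_mod_cast hN2
  have I1 : (∫ p in cube 1, 1 / ((N : ℝ) - p 0)) =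
      Literature.NumberTheory.DiophantineApproximation.DilogPade.polylogSeries 1 (1 / (N : ℝ)) := by
    rw [stub_cubeOneIntegralSeries N hN2, Literature.NumberTheory.DiophantineApproximation.DilogPade.polylogSeries]
    exact tsum_congr fun k => by rw [pow_one]
  have I2 : (∫ p in cube 2, 1 / ((N : ℝ) - p 0 * p 1)) =
      Literature.NumberTheory.DiophantineApproximation.DilogPade.polylogSeries 2 (1 / (N : ℝ)) := by
    rw [stub_cubeTwoIntegralSeriesLevel (N : ℝ) hNR, Literature.NumberTheory.DiophantineApproximation.DilogPade.polylogSeries]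
  have I1' : (∫ p in cube 1, 1 / ((-(N : ℝ)) - p 0)) =
      Literature.NumberTheory.DiophantineApproximation.DilogPade.polylogSeries 1 (-(1 / (N : ℝ))) := by
    rw [stub_dupJoinValueNegOne N hN2, Literature.NumberTheory.DiophantineApproximation.DilogPade.polylogSeries]
    exact tsum_congr fun k => by rw [pow_one]
  have I2' : (∫ p in cube 2, 1 / ((-(N : ℝ)) - p 0 * p 1)) =
      Literature.NumberTheory.DiophantineApproximation.DilogPade.polylogSeries 2 (-(1 / (N : ℝ))) := by
    rw [stub_dupJoinValueNegTwo N hN2, Literature.NumberTheory.DiophantineApproximation.DilogPade.polylogSeries]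
  rw [I1, I2, I1', I2'] at h
  exact Literature.NumberTheory.DiophantineApproximation.dilogTwoPoints_linearIndependent N hN a b₁ c₁ b₂ c₂ h

end Summit.KontsevichZagierPeriods.HermiteRigidity.ReductionRigidity

end
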